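import Summits.HodgeConjecture.HodgeConjecture.Cruxes.BlochSeedDiscOne.DepthBoundA4

/-!
# HalfCosetGadget — the 32-cell half of an `S₀`-coset kills every (A1)-scope word (plan-lens-HodgeAV-extremal g8, memo-08 §5(b))

Token: line stmt-HodgeConjecture-18881 Cruxes/BlochSeedDiscOne/Lines/birth.lean 814a6a70c14e831a stub_rung_pad4_seedAt.

EVIDENCE-LEVEL TYPED FILE (kernel-checked finite facts about the rotation torus `(ℤ∕4)⁴`; NOT a rung; nothing here is proved toward
HC ∕ HC_CM ∕ HC_AV ∕ №4 ∕ 26512 ∕ 18881 ∕ H2; letters ≠ sheaves ≠ a SEED).  Model of record: `DepthBoundA4.lean` v1.8 (`Word`, `Sym.phase`,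
`Word.rotPhase`, `rotCell`, `cellCoef_rotCell_phase`, `InS0`).

CONTENT.  For a rotation vector `k : Fin 4 → Fin 4` put `Σk = Σ_f k_f (mod 4)` and `ψ(k) = k₁ + 2k₂ + 3k₃ (mod 4)` (slots `0,1,2,3`).
The HALF-COSET `X_{s,t} = {k : Σk ≡ s, ψ(k) ∈ {t, t+1}}` has 32 elements (half of the `S₀`-coset `Σk ≡ s`), and for EVERY word `w`
in the scope of (A1).1 (not e-free, `w ≠ eeee`, `w ≠ ēēēē`) the character sum `Σ_{k ∈ X_{s,t}} ρ(w,k)` VANISHES (`ρ = Word.rotPhase`),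
while on `eeee` it equals `32·(−i)^s`.  By `cellCoef_rotCell_phase` this says: the 32-cell design `{rotCell k x : k ∈ X_{s,t}}` (any base
cell `x`, multiplicity 1 each) has `T(w) = 0` on the whole (A1).1 scope and `μ = 32·(−i)^s·cellCoef x eeee` — a μ-carrying piece that is
(A1)-mixed-clean ON ITS OWN with 32 cells, half of the smallest such `S₀`-invariant piece (64).  The QUARTER set `ψ(k) = t` (16 cells)
is NOT clean: the word `e ē e ē` survives (witness below).  Pencil context (memo-08 §5(b)): on one `S₀`-coset a non-negative mass function
is clean iff it lies in the 7-dimensional span of the trivial character and the six characters `(0,1,2,3)·S₃`; cleanness forces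
`m(k) + m(k + (1,1,1,1))` constant, hence ≥ 32 cells for a μ-carrying clean piece, with equality exactly on transversals such as `X_{s,t}`.

THEOREMS (all kernel-checked): `halfCosetKs_length` (|X_{s,t}| = 32, all s,t) · `halfCosetKs_sum` (X_{s,t} ⊂ the S₀-coset s) ·
`halfCoset_kills_scope_pattern` (81 phase patterns × 16 half-cosets, `decide +kernel`) · `halfCoset_kills_scope` (every word in the (A1).1
scope, via the strip bridge `rotPhase_strip`) · `halfCoset_eeee` (Bloch sum = 32·(−i)^s) · `quarterCoset_not_clean` (16-cell quarter: `e ē e ē`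
survives) · `signCoset_clean_mu_zero` (the sign coset {0,2}⁴ is clean but μ = 0) · DESIGN LEVEL: `halfCosetDesignN_T`
(T(w) = charSum · cellCoef x w for the 32-cell piece on ANY base cell x), `halfCosetDesignN_mixed_clean` ((A1).1 for the piece alone),
`halfCosetDesignN_mu` (μ = 32·(−i)^s·cellCoef x eeee).  `#print axioms halfCosetDesignN_mixed_clean` = [propext, Classical.choice, Quot.sound].

NOT CLAIMED: (A1).2 (T(EEEE) = 0) and the six e-free rows do NOT vanish on the piece alone — in a design they are balanced ACROSS pieces
(memo-08 §5–§6: at ring 6 no combination of such pieces balances them within M ≤ 199; class-level certificate).  (A4) is not addressed here.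

Kernel hygiene: imports `DepthBoundA4` only; `decide +kernel` on closed finite statements (farm wall ≈ 155 s); 0 `sorry`; no
`native_decide`; no axiom ∕ instance ∕ notation; no `set_option allowUnsafeReducibility`.
-/

set_option linter.dupNamespace false
set_option autoImplicit false
set_option maxRecDepth 4096
set_option maxHeartbeats 4000000
set_option synthInstance.maxHeartbeats 400000
set_option synthInstance.maxSize 1024

namespace Summit.HodgeConjecture.HodgeConjecture.Cruxes.BlochSeedDiscOne.DepthBoundA4

section halfcoset

/-- all `4⁴ = 256` rotation vectors, as an explicit list. -/
def allK : List (Fin 4 → Fin 4) :=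
  (List.finRange 4).flatMap fun a => (List.finRange 4).flatMap fun b =>
    (List.finRange 4).flatMap fun c => (List.finRange 4).map fun d => ![a, b, c, d]

/-- `Σ_f k_f (mod 4)` — the `S₀`-coset label. -/
def sumK (k : Fin 4 → Fin 4) : ℕ := ((k 0).val + (k 1).val + (k 2).val + (k 3).val) % 4

/-- `ψ(k) = k₁ + 2k₂ + 3k₃ (mod 4)` — the linear form `(0,1,2,3)·k` selecting the half. -/
def psiK (k : Fin 4 → Fin 4) : ℕ := ((k 1).val + 2 * (k 2).val + 3 * (k 3).val) % 4

/-- the HALF-COSET `X_{s,t} = {k : Σk ≡ s, ψ(k) ∈ {t, t+1}}`. -/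
def halfCosetKs (s t : Fin 4) : List (Fin 4 → Fin 4) :=
  allK.filter fun k => decide (sumK k = s.val ∧ (psiK k = t.val ∨ psiK k = (t.val + 1) % 4))

/-- the QUARTER set `{k : Σk ≡ s, ψ(k) = t}` (control: NOT clean). -/
def quarterCosetKs (s t : Fin 4) : List (Fin 4 → Fin 4) :=
  allK.filter fun k => decide (sumK k = s.val ∧ psiK k = t.val)

/-- character sum of a word over a list of rotation vectors: `Σ_k ρ(w,k)`. -/
def charSum (w : Word) (L : List (Fin 4 → Fin 4)) : GaussianInt := (L.map fun k => w.rotPhase k).sum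

theorem allK_length : allK.length = 256 := by decide +kernel

/-- `|X_{s,t}| = 32` for all `s, t`. -/
theorem halfCosetKs_length : ∀ s t : Fin 4, (halfCosetKs s t).length = 32 := by decide +kernel

/-- `X_{s,t}` lies in the `S₀`-coset `Σk ≡ s`. -/
theorem halfCosetKs_sum : ∀ s t : Fin 4, ∀ k ∈ halfCosetKs s t, sumK k = s.val := by decide +kernel

/-- `ρ(w,k)` only sees the PHASE PATTERN of `w`: strip e-free symbols to `1`. -/
def Sym.strip (σ : Sym) : Sym := if σ.efree then Sym.one else σ

theorem Sym.strip_phase (σ : Sym) : σ.strip.phase = σ.phase := by cases σ <;> rfl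
theorem Sym.strip_efree (σ : Sym) : σ.strip.efree = σ.efree := by cases σ <;> rfl
theorem Sym.strip_strip (σ : Sym) : σ.strip.strip = σ.strip := by cases σ <;> rfl
theorem Sym.strip_eq_e (σ : Sym) : σ.strip = Sym.e ↔ σ = Sym.e := by cases σ <;> simp [Sym.strip, Sym.efree]
theorem Sym.strip_eq_ebar (σ : Sym) : σ.strip = Sym.ebar ↔ σ = Sym.ebar := by cases σ <;> simp [Sym.strip, Sym.efree]

/-- the four symbols are already stripped (i.e. lie in `{1, e, ē}`). -/
def stripFixed (a b c d : Sym) : Bool := decide (a.strip = a ∧ b.strip = b ∧ c.strip = c ∧ d.strip = d)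

/-- **THE GADGET (pattern form, kernel).** For every PHASE PATTERN in the scope of (A1).1 (symbols in `{1, e, ē}`, not all `1`, not `eeee`,
not `ēēēē`) and every `s, t`, the character sum over the half-coset vanishes (81 patterns × 16 half-cosets, `decide +kernel`). -/
theorem halfCoset_kills_scope_pattern :
    ∀ a b c d : Sym, stripFixed a b c d = true →
      ¬ (∀ f : Fin 4, ((![a, b, c, d] : Word) f).efree = true) → (![a, b, c, d] : Word) ≠ Word.eeee → (![a, b, c, d] : Word) ≠ Word.EEEE →
      ∀ s t : Fin 4, charSum ![a, b, c, d] (halfCosetKs s t) = 0 := by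
  decide +kernel

theorem word_eq_vec (w : Word) : w = ![w 0, w 1, w 2, w 3] := by
  funext f; fin_cases f <;> rfl

/-- the stripped word (e-free symbols replaced by `1`). -/
def Word.strip (w : Word) : Word := fun f => (w f).strip

theorem rotPhase_strip (w : Word) (k : Fin 4 → Fin 4) : w.strip.rotPhase k = w.rotPhase k := by
  unfold Word.rotPhase Word.strip
  exact Finset.prod_congr rfl fun f _ => by rw [Sym.strip_phase]

theorem charSum_strip (w : Word) (L : List (Fin 4 → Fin 4)) : charSum w.strip L = charSum w L := by
  unfold charSum
  congr 1
  exact List.map_congr_left fun k _ => rotPhase_strip w k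

/-- **THE GADGET.** `Σ_{k ∈ X_{s,t}} ρ(w,k) = 0` for every word `w` that (A1).1 constrains. -/
theorem halfCoset_kills_scope (w : Word) (h1 : ¬ w.efree) (h2 : w ≠ Word.eeee) (h3 : w ≠ Word.EEEE) (s t : Fin 4) :
    charSum w (halfCosetKs s t) = 0 := by
  rw [← charSum_strip]
  have hv : w.strip = ![(w 0).strip, (w 1).strip, (w 2).strip, (w 3).strip] := by
    funext f; fin_cases f <;> rfl
  have h1' : ¬ (∀ f : Fin 4, ((![(w 0).strip, (w 1).strip, (w 2).strip, (w 3).strip] : Word) f).efree = true) := by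
    intro hall
    apply h1
    intro f
    have := hall f
    rw [← hv] at this
    simpa [Word.strip, Sym.strip_efree] using this
  have h2' : (![(w 0).strip, (w 1).strip, (w 2).strip, (w 3).strip] : Word) ≠ Word.eeee := by
    intro heq
    apply h2
    rw [← hv] at heq
    funext f
    have := congrFun heq f
    simp only [Word.strip, Word.eeee] at this
    exact (Sym.strip_eq_e _).1 this
  have h3' : (![(w 0).strip, (w 1).strip, (w 2).strip, (w 3).strip] : Word) ≠ Word.EEEE := by
    intro heq
    apply h3
    rw [← hv] at heq
    funext f
    have := congrFun heq f
    simp only [Word.strip, Word.EEEE] at this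
    exact (Sym.strip_eq_ebar _).1 this
  rw [hv]
  have hfix : stripFixed (w 0).strip (w 1).strip (w 2).strip (w 3).strip = true := by
    simp [stripFixed, Sym.strip_strip]
  exact halfCoset_kills_scope_pattern _ _ _ _ hfix h1' h2' h3' s t

/-- On the Bloch word the half-coset sum is `32·(−i)^s` (so the piece carries `μ = 32·(−i)^s·cellCoef x eeee`). -/
theorem halfCoset_eeee : ∀ s t : Fin 4, charSum Word.eeee (halfCosetKs s t) = 32 * (⟨0, -1⟩ : GaussianInt) ^ s.val := by
  decide +kernel

/-- CONTROL: the quarter set is NOT clean — the scope word `e ē e ē` has a non-zero character sum on it (`s = 1, t = 0`). -/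
theorem quarterCoset_not_clean :
    (quarterCosetKs 1 0).length = 16 ∧ charSum ![Sym.e, Sym.ebar, Sym.e, Sym.ebar] (quarterCosetKs 1 0) ≠ 0 := by
  decide +kernel

/-- CONTROL: the 16-element SIGN coset `{0,2}⁴` is clean but kills `eeee` as well (μ = 0 pieces). -/
def signCosetKs : List (Fin 4 → Fin 4) := allK.filter fun k => decide (∀ f : Fin 4, (k f).val % 2 = 0)

theorem signCoset_clean_mu_zero :
    signCosetKs.length = 16 ∧ charSum Word.eeee signCosetKs = 0 ∧
    ∀ a b c d : Sym, stripFixed a b c d = true →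
      ¬ (∀ f : Fin 4, ((![a, b, c, d] : Word) f).efree = true) → charSum ![a, b, c, d] signCosetKs = 0 := by
  decide +kernel

/-! ### Design-level corollary: the 32-cell piece is (A1).1-clean on its own, with `μ = 32·(−i)^s·cellCoef x eeee` -/

/-- the half-coset piece on a base cell `x`: the cells `rotCell k x`, `k ∈ X_{s,t}`, multiplicity 1 each, on the N side. -/
def halfCosetDesignN (x : Cell) (s t : Fin 4) : Design :=
  ⟨(halfCosetKs s t).map fun k => (rotCell k x, 1), []⟩

theorem halfCosetDesignN_T (x : Cell) (s t : Fin 4) (w : Word) :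
    (halfCosetDesignN x s t).T w = charSum w (halfCosetKs s t) * cellCoef x w := by
  unfold halfCosetDesignN Design.T charSum
  simp only [List.map_map, List.map_nil, List.sum_nil, sub_zero]
  rw [← List.sum_map_mul_right]
  congr 1
  apply List.map_congr_left
  intro k _
  simp [Function.comp, cellCoef_rotCell_phase]

/-- (A1).1 holds for the 32-cell piece alone, for EVERY base cell. -/
theorem halfCosetDesignN_mixed_clean (x : Cell) (s t : Fin 4) :
    ∀ w : Word, ¬ w.efree → w ≠ Word.eeee → w ≠ Word.EEEE → (halfCosetDesignN x s t).T w = 0 := by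
  intro w h1 h2 h3
  rw [halfCosetDesignN_T, halfCoset_kills_scope w h1 h2 h3 s t, zero_mul]

/-- … and its Bloch coefficient is `32·(−i)^s·∏_f star β(x_f)`. -/
theorem halfCosetDesignN_mu (x : Cell) (s t : Fin 4) :
    (halfCosetDesignN x s t).mu = 32 * (⟨0, -1⟩ : GaussianInt) ^ s.val * cellCoef x Word.eeee := by
  unfold Design.mu
  rw [halfCosetDesignN_T, halfCoset_eeee s t]

end halfcoset

end Summit.HodgeConjecture.HodgeConjecture.Cruxes.BlochSeedDiscOne.DepthBoundA4
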